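import Literature.Analysis.FluidPDE.CollisionalTransferFunctional
import Literature.Analysis.FluidPDE.HardSphereCollisionRecord
import Literature.Analysis.FluidPDE.HardSpherePhaseSpaceProofs
import Literature.MathematicalPhysics.KineticTheory.HardSphereEuler
import Mathlib.MeasureTheory.Covering.BesicovitchVectorSpace
import HarnessLib

/-!
# Contact kinematics on `𝕋³` for the co-moving pair virial (helper for stub `stub_activityDomination`, line SketchK1)

Crux `Summit.AtomisticToContinuum.HydrodynamicLimit.Theses.OneFlightGossipEngine.CollisionActivityTails`
(stmt-AtomisticToContinuum-13734), line `SketchK1`, stub `stub_activityDomination : ActivityDomination`.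
Tools shared by the per-collision step (`…CollisionActivityTailsCollisionStep`) and the window assembly:

* minimal images on the flat torus: additivity away from the cut locus (`reprSym_sub_reprSym`), the minimal-image
  distance `tdist` with its triangle inequality, the hard-core packing bound `card_near_le` (at most `125` centres
  within `2ε` of a centre in the hard-sphere domain; `Besicovitch.card_le_of_separated`), `nearCount`,
  `three_le_nearCount`;
* per-collision quantities of a curve `γ`: `impulse`, `ownImpulse` (the crux's summand at one collision time),
  `crowdImpulse` (the crowded-activity summand), and the co-moving pair virial `pairVirial ζ i`;
* kinematics at a contact pair of a hard-sphere trajectory (`contact_kinematics`): the partner's jump is opposite, the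
  other spheres do not jump, and `Δv_a = c (x_a − x_b)` with `c > 0` (repulsive elastic contact), `|Δv_a| = cε`;
  the jump of the pair virial as a particle sum (`collisionJump_pairVirial`) and contact-pair sums over the two
  orientations (`sum_contactPairs_pair`).
The registered helper statement is `ContactToolkit`.
-/

noncomputable section

open Set Filter Topology Function
open scoped InnerProductSpace

namespace Summit.AtomisticToContinuum.HydrodynamicLimit.Theorems.CollisionActivityTailsContact

open Literature.Analysis.FluidPDE Literature.Analysis.FunctionSpaces
open Literature.MathematicalPhysics.KineticTheory (T3 V3)

/-- The **co-moving localized pair virial** of the tagged sphere `i` (verbatim the definition of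
`…CollisionActivityTailsPairVirial.pairVirial`, repeated so that this file stands alone):
`Σ_j ⟪ζ(sep(x_j, x_i)), v_j − v_i⟫`, `sep(x_j, x_i) = reprSym (x_j − x_i)` the minimal-image separation. -/
def pairVirial {n : ℕ} (ζ : V3 → V3) (i : Fin n) (y : Config n (Fin 3) T3) : ℝ :=
  ∑ j, ⟪ζ (Torus.reprSym ((y j).1 - (y i).1)), (y j).2 - (y i).2⟫_ℝ

/-! ## Minimal images: additivity away from the cut locus, triangle inequality -/

/-- **Minimal images add up away from the cut locus**: if `‖reprSym u‖ + ‖reprSym v‖ + ‖reprSym (u − v)‖ < 1` then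
`reprSym u − reprSym v = reprSym (u − v)` (coordinatewise the difference is an integer of absolute value `< 1`). -/
theorem reprSym_sub_reprSym {u v : T3}
    (h : ‖Torus.reprSym u‖ + ‖Torus.reprSym v‖ + ‖Torus.reprSym (u - v)‖ < 1) :
    Torus.reprSym u - Torus.reprSym v = Torus.reprSym (u - v) := by
  ext k
  rw [PiLp.sub_apply]
  set α := Torus.reprSym u k
  set β := Torus.reprSym v k
  set δ := Torus.reprSym (u - v) k
  have hcoe : (((α - β - δ : ℝ)) : UnitAddCircle) = 0 := by
    rw [AddCircle.coe_sub, AddCircle.coe_sub, Torus.coe_reprSym_apply, Torus.coe_reprSym_apply,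
      Torus.coe_reprSym_apply, Pi.sub_apply, sub_self]
  obtain ⟨m, hm⟩ := (AddCircle.coe_eq_zero_iff (1 : ℝ)).1 hcoe
  rw [zsmul_eq_mul, mul_one] at hm
  have hα := Torus.abs_reprSym_apply_le_norm u k
  have hβ := Torus.abs_reprSym_apply_le_norm v k
  have hδ := Torus.abs_reprSym_apply_le_norm (u - v) k
  have habs : |α - β - δ| < 1 := by
    calc |α - β - δ| ≤ |α - β| + |δ| := abs_sub _ _
      _ ≤ |α| + |β| + |δ| := by linarith [abs_sub α β]
      _ < 1 := by linarith
  have hm0 : m = 0 := by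
    have h1 : |(m : ℝ)| < 1 := by rw [hm]; exact habs
    have h2 : |m| < 1 := by exact_mod_cast h1
    exact Int.abs_lt_one_iff.1 h2
  rw [hm0, Int.cast_zero] at hm
  linarith

/-- Minimal-image distance of two points of `𝕋³`. -/
def tdist (x y : T3) : ℝ := ‖(Torus.geometry (Fin 3)).sepVec x y‖

/-- `tdist x y = ‖reprSym (x − y)‖`. -/
theorem tdist_eq (x y : T3) : tdist x y = ‖Torus.reprSym (x - y)‖ := rfl

/-- The minimal-image distance is symmetric. -/
theorem tdist_comm (x y : T3) : tdist x y = tdist y x := Torus.euclidDist_comm x y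

/-- `tdist x x = 0`. -/
theorem tdist_self (x : T3) : tdist x x = 0 := by
  rw [tdist_eq, sub_self, Torus.reprSym_zero, norm_zero]

/-- **Triangle inequality** for the minimal-image distance. -/
theorem tdist_triangle (x y z : T3) : tdist x z ≤ tdist x y + tdist y z := by
  have h := Torus.euclidDist_proj_le_norm_sub_holds (Torus.reprSym (x - y) + Torus.reprSym (y - z)) 0
  rw [Torus.proj_add, Torus.proj_reprSym, Torus.proj_reprSym, Torus.proj_zero, sub_zero,
    Torus.euclidDist_eq, sub_zero, show x - y + (y - z) = x - z by abel] at h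
  exact h.trans (norm_add_le _ _)

/-- Lift of the centre `x_j` relative to `x_i` to `ℝ³`: `reprSym (x_j − x_i)`. -/
def liftVec {n : ℕ} (y : Config n (Fin 3) T3) (i j : Fin n) : V3 := Torus.reprSym ((y j).1 - (y i).1)

/-- Two lifts relative to the same centre are at least as far apart as the two centres on the torus. -/
theorem tdist_le_norm_liftVec_sub {n : ℕ} (y : Config n (Fin 3) T3) (i j j' : Fin n) :
    tdist (y j).1 (y j').1 ≤ ‖liftVec y i j - liftVec y i j'‖ := by
  have h := Torus.euclidDist_proj_le_norm_sub_holds (liftVec y i j) (liftVec y i j')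
  have hj : Torus.proj (liftVec y i j) = (y j).1 - (y i).1 := Torus.proj_reprSym _
  have hj' : Torus.proj (liftVec y i j') = (y j').1 - (y i).1 := Torus.proj_reprSym _
  rw [hj, hj', Torus.euclidDist_eq, sub_sub_sub_cancel_right] at h
  exact h

/-- **Hard-core packing** (as in `…CollisionActivityTailsEndpointKinematics.card_near_le`): in the hard-sphere domain of
diameter `ε > 0` at most `125 = 5³` centres lie within `2ε` of a given centre (`Besicovitch.card_le_of_separated`). -/
theorem card_near_le {n : ℕ} {ε : ℝ} (hε : 0 < ε) {y : Config n (Fin 3) T3}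
    (hy : y ∈ hardSphereDomain (Torus.geometry (Fin 3)) n ε) (i : Fin n) :
    (Finset.univ.filter fun j : Fin n => tdist (y j).1 (y i).1 ≤ 2 * ε).card ≤ 125 := by
  classical
  set S := Finset.univ.filter fun j : Fin n => tdist (y j).1 (y i).1 ≤ 2 * ε with hS
  set f : Fin n → V3 := fun j => ε⁻¹ • liftVec y i j with hf
  have hsep : ∀ j j', j ≠ j' → 1 ≤ ‖f j - f j'‖ := by
    intro j j' hjj'
    have h1 : ε ≤ tdist (y j).1 (y j').1 := hy j j' hjj'
    have h2 := tdist_le_norm_liftVec_sub y i j j'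
    rw [hf, ← smul_sub, norm_smul, norm_inv, Real.norm_eq_abs, abs_of_pos hε,
      ← div_eq_inv_mul, le_div_iff₀ hε, one_mul]
    exact h1.trans h2
  have hinj : Set.InjOn f S := by
    intro j _ j' _ hjj'
    by_contra hne
    have h := hsep j j' hne
    rw [hjj', sub_self, norm_zero] at h
    exact absurd h (by norm_num)
  have hnorm : ∀ c ∈ S.image f, ‖c‖ ≤ 2 := by
    intro c hc
    obtain ⟨j, hj, rfl⟩ := Finset.mem_image.1 hc
    have hj' : tdist (y j).1 (y i).1 ≤ 2 * ε := (Finset.mem_filter.1 hj).2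
    have hn : ‖liftVec y i j‖ = tdist (y j).1 (y i).1 := rfl
    rw [hf, norm_smul, norm_inv, Real.norm_eq_abs, abs_of_pos hε, hn, inv_mul_le_iff₀ hε]
    linarith
  have hsep' : ∀ c ∈ S.image f, ∀ d ∈ S.image f, c ≠ d → 1 ≤ ‖c - d‖ := by
    intro c hc d hd hcd
    obtain ⟨j, -, rfl⟩ := Finset.mem_image.1 hc
    obtain ⟨j', -, rfl⟩ := Finset.mem_image.1 hd
    exact hsep j j' fun h => hcd (by rw [h])
  calc S.card = (S.image f).card := (Finset.card_image_of_injOn hinj).symm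
    _ ≤ 5 ^ Module.finrank ℝ V3 := Besicovitch.card_le_of_separated _ hnorm hsep'
    _ = 125 := by rw [finrank_euclideanSpace_fin]; norm_num

/-- Number of centres within distance `r` of the centre of particle `i` (itself included). -/
def nearCount {n : ℕ} (y : Config n (Fin 3) T3) (i : Fin n) (r : ℝ) : ℕ :=
  (Finset.univ.filter fun j : Fin n => tdist (y j).1 (y i).1 ≤ r).card

/-- Three distinct centres within `r` of `x_i` give `3 ≤ nearCount`. -/
theorem three_le_nearCount {n : ℕ} {y : Config n (Fin 3) T3} {i : Fin n} {r : ℝ} {a b c : Fin n}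
    (hab : a ≠ b) (hac : a ≠ c) (hbc : b ≠ c) (ha : tdist (y a).1 (y i).1 ≤ r)
    (hb : tdist (y b).1 (y i).1 ≤ r) (hc : tdist (y c).1 (y i).1 ≤ r) : 3 ≤ nearCount y i r := by
  classical
  unfold nearCount
  have hsub : ({a, b, c} : Finset (Fin n)) ⊆ Finset.univ.filter fun j : Fin n => tdist (y j).1 (y i).1 ≤ r := by
    intro j hj
    simp only [Finset.mem_insert, Finset.mem_singleton] at hj
    rw [Finset.mem_filter]
    rcases hj with rfl | rfl | rfl
    · exact ⟨Finset.mem_univ _, ha⟩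
    · exact ⟨Finset.mem_univ _, hb⟩
    · exact ⟨Finset.mem_univ _, hc⟩
  have hcard : ({a, b, c} : Finset (Fin n)).card = 3 := Finset.card_eq_three.2 ⟨a, b, c, hab, hac, hbc, rfl⟩
  calc 3 = ({a, b, c} : Finset (Fin n)).card := hcard.symm
    _ ≤ _ := Finset.card_le_card hsub

/-! ## Per-collision quantities -/

variable {n : ℕ}

/-- The impulse `|v_k(t⁺) − v_k(t⁻)|` of particle `k` at time `t` along the curve `γ`. -/
def impulse (γ : ℝ → Config n (Fin 3) T3) (t : ℝ) (k : Fin n) : ℝ := ‖(γ t k).2 - (leftLim γ t k).2‖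

/-- **Own impulse** of the tagged sphere `i` at time `t`: the contact-pair sum of `𝟙{p = i} |Δv_p|`
(`= |Δv_i|` if `i` collides at `t`, `0` otherwise) — the crux's summand at one collision time. -/
def ownImpulse (ε : ℝ) (γ : ℝ → Config n (Fin 3) T3) (i : Fin n) (t : ℝ) : ℝ :=
  ∑ p ∈ contactPairs (Torus.geometry (Fin 3)) ε (γ t), if p.1 = i then impulse γ t p.1 else 0

/-- **Crowd impulse** at the tagged sphere `i` at time `t`: the contact-pair sum of `|Δv_p|` over the pairs with both
partners within `3ε` of `x_i` while at least three centres lie within `3ε` of `x_i` — the crowded-activity summand. -/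
def crowdImpulse (ε : ℝ) (γ : ℝ → Config n (Fin 3) T3) (i : Fin n) (t : ℝ) : ℝ :=
  ∑ p ∈ contactPairs (Torus.geometry (Fin 3)) ε (γ t),
    if tdist (γ t p.1).1 (γ t i).1 ≤ 3 * ε ∧ tdist (γ t p.2).1 (γ t i).1 ≤ 3 * ε ∧
        3 ≤ nearCount (γ t) i (3 * ε) then impulse γ t p.1 else 0

/-! ## Kinematics at a contact pair -/

section Kinematics

variable {ε : ℝ} {γ : ℝ → Config n (Fin 3) T3}

/-- Shorthand for the torus geometry of `𝕋³`. -/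
local notation "G3" => Torus.geometry (Fin 3)

/-- The torus translations are continuous. -/
theorem continuous_translate (x : T3) : Continuous ((Torus.geometry (Fin 3)).translate x) :=
  (continuous_const.add Torus.continuous_proj : Continuous fun v : V3 => x + Torus.proj v)

/-- For `ε ≤ 1/8` the torus geometry is hard-sphere regular at diameter `ε`. -/
theorem regular (hε8 : ε ≤ 1 / 8) : (Torus.geometry (Fin 3)).IsHardSphereRegular ε :=
  Torus.isHardSphereRegular_geometry (by norm_num at hε8 ⊢; linarith)

/-- At a contact pair `(a, b)` of a hard-sphere trajectory: `a ≠ b`, the separation has norm `ε`, the partner's jump is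
opposite, the other particles do not jump, and the jump of `a` is a POSITIVE multiple of the separation
`x_a − x_b` (repulsive elastic contact): `Δv_a = c (x_a − x_b)`, `c > 0`, `|Δv_a| = c ε`. -/
theorem contact_kinematics (hγ : IsHardSphereTrajectory G3 ε n γ) {t : ℝ}
    {a b : Fin n} (hab : (a, b) ∈ contactPairs G3 ε (γ t)) :
    a ≠ b ∧ ‖(Torus.geometry (Fin 3)).sepVec (γ t a).1 (γ t b).1‖ = ε ∧
    (γ t b).2 - (leftLim γ t b).2 = -((γ t a).2 - (leftLim γ t a).2) ∧
    (∀ k, k ≠ a → k ≠ b → (γ t k).2 - (leftLim γ t k).2 = 0) ∧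
    ∃ c : ℝ, 0 < c ∧ (γ t a).2 - (leftLim γ t a).2 = c • (Torus.geometry (Fin 3)).sepVec (γ t a).1 (γ t b).1 ∧
      impulse γ t a = c * ε := by
  obtain ⟨hne, hc⟩ := mem_contactPairs.1 hab
  have hnorm : ‖(Torus.geometry (Fin 3)).sepVec (γ t a).1 (γ t b).1‖ = ε := (mem_contactSet.1 hc).2
  have hGt := continuous_translate
  refine ⟨hne, hnorm, hγ.vel_sub_leftLim_right_eq_neg hne hc, fun k hka hkb => ?_, ?_⟩
  · rw [hγ.apply_eq_leftLim_apply_of_ne hne hc hka hkb, sub_self]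
  · set nv := (Torus.geometry (Fin 3)).sepVec (γ t a).1 (γ t b).1 with hnv
    set c : ℝ := -(⟪(leftLim γ t a).2 - (leftLim γ t b).2, nv⟫_ℝ / ‖nv‖ ^ 2) with hcdef
    have hΔ : (γ t a).2 - (leftLim γ t a).2 = c • nv := by
      rw [hγ.vel_sub_leftLim_eq_smul hGt hne hc, hcdef, neg_smul]
    have hposin : 0 < ⟪nv, (γ t a).2 - (leftLim γ t a).2⟫_ℝ := hγ.inner_sepVec_vel_sub_leftLim_pos hGt hne hc
    rw [hΔ, inner_smul_right, real_inner_self_eq_norm_sq, hnorm] at hposin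
    have hcpos : 0 < c := pos_of_mul_pos_left hposin (sq_nonneg ε) |> fun h => by
      rcases (mul_pos_iff.1 hposin) with ⟨h1, -⟩ | ⟨-, h2⟩
      · exact h1
      · exact absurd h2 (not_lt.2 (sq_nonneg ε))
    refine ⟨c, hcpos, hΔ, ?_⟩
    rw [impulse, hΔ, norm_smul, Real.norm_eq_abs, abs_of_pos hcpos, hnorm]

end Kinematics

/-! ## The jump of the pair virial -/

section Jump

variable {ε : ℝ} {γ : ℝ → Config n (Fin 3) T3}

local notation "G3" => Torus.geometry (Fin 3)

/-- The jump of the pair virial at time `t` as a sum over the particles: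
`Σ_j ⟪ζ(sep(x_j, x_i)), Δv_j − Δv_i⟫` (positions do not jump). -/
theorem collisionJump_pairVirial (hε8 : ε ≤ 1 / 8) (hγ : IsHardSphereTrajectory G3 ε n γ) (ζ : V3 → V3)
    (i : Fin n) (t : ℝ) :
    collisionJump (pairVirial ζ i) γ t =
      ∑ j, ⟪ζ (Torus.reprSym ((γ t j).1 - (γ t i).1)),
        ((γ t j).2 - (leftLim γ t j).2) - ((γ t i).2 - (leftLim γ t i).2)⟫_ℝ := by
  have _ := hε8
  have hpos : ∀ k, (leftLim γ t k).1 = (γ t k).1 := hγ.leftLim_apply_fst continuous_translate t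
  unfold collisionJump pairVirial
  rw [← Finset.sum_sub_distrib]
  refine Finset.sum_congr rfl fun j _ => ?_
  rw [hpos, hpos, ← inner_sub_right]
  congr 1
  abel

end Jump

section Pair

variable {n : ℕ} {ε : ℝ} {γ : ℝ → Config n (Fin 3) T3}

local notation "G3" => Torus.geometry (Fin 3)

/-- The two sums over the contact pairs `{(a,b), (b,a)}`. -/
theorem sum_contactPairs_pair (hε8 : ε ≤ 1 / 8) (hγ : IsHardSphereTrajectory G3 ε n γ) {t : ℝ} {a b : Fin n}
    (hab : (a, b) ∈ contactPairs G3 ε (γ t)) (f : Fin n × Fin n → ℝ) :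
    ∑ p ∈ contactPairs G3 ε (γ t), f p = f (a, b) + f (b, a) := by
  have hne : a ≠ b := (mem_contactPairs.1 hab).1
  rw [hγ.contactPairs_eq_pair (regular hε8) hab, Finset.sum_pair]
  intro h
  exact hne (Prod.mk.inj h).1

end Pair

/-! ## The registered helper statement -/

/-- **Contact toolkit** (helper statement of stub `stub_activityDomination`, line SketchK1): at every contact pair
`(a, b)` of a hard-sphere trajectory on `𝕋³`: `a ≠ b`, `‖x_a − x_b‖ = ε`, `Δv_b = −Δv_a`, the other spheres do not
jump, and `Δv_a = c (x_a − x_b)` for some `c > 0` with `|Δv_a| = cε`. -/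
def ContactToolkit : Prop :=
  ∀ (n : ℕ) (ε : ℝ) (γ : ℝ → Config n (Fin 3) T3), IsHardSphereTrajectory (Torus.geometry (Fin 3)) ε n γ →
    ∀ (t : ℝ) (a b : Fin n), (a, b) ∈ contactPairs (Torus.geometry (Fin 3)) ε (γ t) →
    a ≠ b ∧ ‖(Torus.geometry (Fin 3)).sepVec (γ t a).1 (γ t b).1‖ = ε ∧
    (γ t b).2 - (leftLim γ t b).2 = -((γ t a).2 - (leftLim γ t a).2) ∧
    (∀ k, k ≠ a → k ≠ b → (γ t k).2 - (leftLim γ t k).2 = 0) ∧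
    ∃ c : ℝ, 0 < c ∧ (γ t a).2 - (leftLim γ t a).2 = c • (Torus.geometry (Fin 3)).sepVec (γ t a).1 (γ t b).1 ∧
      impulse γ t a = c * ε

/-- The contact toolkit holds (registered helper `stub_contactToolkit` of line SketchK1). -/
theorem stub_contactToolkit : ContactToolkit :=
  fun _n _ε _γ hγ _t _a _b hab => contact_kinematics hγ hab

end Summit.AtomisticToContinuum.HydrodynamicLimit.Theorems.CollisionActivityTailsContact

end
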